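import Summits.QuantumFields.QCD.Theses.HeatSlicedQuarks
import Summits.QuantumFields.QCD.Theses.GradientFlowSpecies
import Summits.QuantumFields.QCD.Theorems.RobustYangMillsHandover.Negative.WithoutNontriviality
import Summits.QuantumFields.QCD.Theorems.RobustYangMillsHandover.Negative.HoppingWindow
import Summits.QuantumFields.QCD.Theorems.HeatSlicedQuarksRobustYangMillsHandoverStubCellDobrushinDecay
import Summits.QuantumFields.QCD.Theorems.HeatSlicedQuarksRobustYangMillsHandoverStubClusterDeployment
import Summits.QuantumFields.QCD.Theorems.HeatSlicedQuarksRobustYangMillsHandoverStubCubeInfluence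
import Literature.MathematicalPhysics.QuantumFieldTheory.BlockScaleEffectivePerturbation
import Literature.MathematicalPhysics.QuantumFieldTheory.QuasiLocalGaugePerturbationCells
import Literature.MathematicalPhysics.QuantumFieldTheory.QuasiLocalGaugePerturbationCovariance
import Literature.MathematicalPhysics.QuantumFieldTheory.BlockCellGeometry
import Literature.MathematicalPhysics.QuantumFieldTheory.MassGapFromLatticeClustering

/-!
# Line `two-scale-lsi-handover` — checked skeleton for the crux
`Summit.QuantumFields.QCD.Theses.HeatSlicedQuarks.RobustYangMillsHandover` (stmt-QuantumFields-8892)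

**Gen 4 = LEAD RESHAPE r2 (prover-line-stmt-QuantumFields-8892-c2-0, 2026-08-16T18Z), forced by two events:**

1. **Summit statement re-type p117723 (17:37Z).** `QCDOf Nf` now conjoins `reg.IsChiralAtZero` (the additive offset
   of `m_crit` is pinned to the chiral point: for every `ε > 0` some POSITIVE mass tuple has no uniform lattice gap `ε`).
   The threshold reading `qcdOf_iff_threshold` (`∀ m > 0 ≡ ∀ m > M₀`), on which the head of EVERY line on this crux
   and Disproof §5/§8 rested, is no longer a theorem (its olean on the farm is stale; see crux dir
   `FINDING-retype-chiral.md`, `RetypeImpact.lean`).  This skeleton therefore imports NOTHING downstream of the old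
   `QCDOf` body (`GluonicCompletion.Negative.Threshold`, `Negative.GapClauses`) and re-cuts the head honestly:
   the mechanism stubs prove, for X₀'s OWN regularisation, the lattice half above a threshold WITH the species
   clustering clause (`latticeGappedCS_of_stubs`), hence the PRE-re-type conjunct in threshold form
   (`QCDOfAboveThreshold`, `aboveThreshold_of_stubs` — sorry-free outside the stubs, no `m_crit` shift needed), and the
   genuinely new content the re-type put INSIDE the crux — the light-quark / chiral completion
   `(∀ Nf ∈ {2,3}, QCDOfAboveThreshold Nf) → QCD` — is ONE explicit registered stub `stub_chiralCompletion`
   (crux-sized: it contains light-quark lattice AND continuum QCD down to the chiral point of a chiral-pinned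
   regularisation; recorded for the planner as promote-stub / restatement material, NOT as work for this line).
2. **The misstated common head `stub_gapTransfer` (= 8923 BY NAME; Disproof §13, lead-0 audit G4/G5) LEAVES the
   skeleton.** The continuum gap clause is now read off the LANDED Literature transfer
   `IsQCDAlong.hasMassGap_of_hasSpeciesCSClustering` (lead c1, `MassGapFromLatticeClustering`), and the lattice side
   owes the species Cauchy–Schwarz clustering clause `HasSpeciesCSClustering` at the same rate: `stub_fineFromBlock`
   becomes `stub_fineFromBlockCS` (same hypotheses, conclusion `HasLatticeMassGap Δ ∧ ∀ z shift, HasSpeciesCSClustering Δ`).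

Gen 3 = lead reshape r1 (prover-line-stmt-QuantumFields-8892-1): stubs 3–4 re-cut along Dobrushin's condition in TV
form — `stub_cellDobrushinDecay` (3a, LANDED p100468), `stub_cubeInfluence` (3b, LANDED this seat),
`stub_clusterDeployment` (4′, LANDED p99520); all three are IMPORTED here, so `CubeClustering` ("KP-small inter-cube
coupling + small residual plaquette coupling ⇒ volume-uniform exponential clustering of species covariances under
μ_{β,D+O}, for ANY bounded cube-diagonal self-interaction D", every compact G) is a sorry-free THEOREM
(`cubeClustering`).  Planner gen 1/2 text, idea card `Ideas/two-scale-lsi-handover.md`, triage `TRIAGE-r1-{1,2,3}.md`,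
line card `Lines/two-scale-lsi-handover.md`, standing disproof `Disproof.lean` (rev 8, §§1–13; `-- Targets`: none),
findings `FINDINGS-g2k1.md`, `FINDING-thresholds-ratios.md`, `FINDING-retype-chiral.md`.

## Registered stubs after reshape r2 (`sorry`s = the open ones)

* `stub_cellDobrushinDecay` (3a)   — LANDED p100468 (imported)
* `stub_cubeInfluence` (3b)       — LANDED (this seat; imported)
* `stub_clusterDeployment` (4′)    — LANDED p99520 (imported)
* `stub_twoScaleYM` (2)            — open: the YM-side named input (hadronic two-scale data in Dobrushin–KP form
                                     along every a.f. sequence); signature UNCHANGED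
* `stub_heavyQuarkBlockRemainder`  — open/XL: blocked on item 14667 `ConstructiveDecouplingRG` (+ crossover transport;
                                     lead-1 audit `HeavyQuarkBlockRemainder-AUDIT.md`); signature UNCHANGED
* `stub_fineFromBlockCS` (6)       — open/XL: 6 + species clause; blocked on item 8693 `RenormalisedQuarkLineBound`
                                     + un-vendored Lüscher trace formula (lead-1 audit `FineFromBlock-AUDIT.md`)
* `stub_chiralCompletion` (7)      — open, CRUX-SIZED, NEW CONTENT OF THE RE-TYPE (not this line's mechanism):
                                     `(∀ Nf ∈ {2,3}, QCDOfAboveThreshold Nf) → QCD`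

Sorry-free: `cubeClustering`, `latticeGappedCS_of_stubs`, `massiveLatticeGap_of_stubs` (item 8922 BY NAME),
`aboveThreshold_of_stubs` (X₀ → threshold-form conjunct for both `N_f`), `RobustYangMillsHandover_of` (the crux BY NAME,
modulo exactly the registered stubs), `fineHopping_lt_sixth_of_honest` (Disproof §12(A), used by stub 6's docstring).

## Disproof.lean, honoured (rev 8; cited by section)

* §1/§7: X₀'s truth value is never used; same-regularisation proof, no `m_crit` shift anywhere (§5/§8's shift is
  exactly what the re-type outlawed on the CONCLUSION side; `aboveThreshold_of_stubs` keeps X₀'s `reg` and puts the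
  threshold into `QCDOfAboveThreshold`'s `∃ M₀`).
* §2 `handoverWithoutNontriviality_iff_qcd` (landed `Negative.WithoutNontriviality`, imported; pure logic, survives the
  re-type): honesty (the three non-triviality clauses) is the hypothesis of stubs 5 and 6.
* §6: the lattice half is `SameRegLatticeGap` above a threshold = item 8922 (`massiveLatticeGap_of_stubs`); the gap
  clauses' monotonicity is not needed (one rate `mr/(4ℓ₁)` for both clauses).
* §9(i)/(ii), §10, §12: as in gen 2/3 (matched `β'`, block-scale objects only, `fineHopping_lt_sixth_of_honest`).
* §13: ANSWERED — no `HasLatticeMassGap ⇒ HasMassGap` step exists any more; the transferred hypothesis is the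
  per-family, `ε`-slack Cauchy–Schwarz clustering of the smeared species correlators (`HasSpeciesCSClustering`).
-/

noncomputable section

namespace Summit.QuantumFields.QCD.Cruxes.RobustYangMillsHandover.TwoScaleLsiHandover

open Summit.QuantumFields.QCD.Theses.HeatSlicedQuarks (ContinuumQCDExists RobustYangMillsHandover)
open Literature.MathematicalPhysics.QuantumFieldTheory Literature.MathematicalPhysics.QuantumLattice
open Literature.MathematicalPhysics.AQFT
open MeasureTheory Filter Topology

/-! ## §0 The uneven axial blocking (new object; definition request `UnevenAxialBlocking`) -/

section Blocking

variable {G : Type*}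

/-- Fine-lattice representative (base corner) of the block site `y` of the block torus of side `T`, for nominal
block factor `b`, inside the fine torus of side `N`: coordinatewise `b · y_i` on representatives `y_i ∈ {0,…,T-1}`.
[folklore] -/
def unevenCorner (b N T : ℕ) (y : Site 4 T) : Site 4 N :=
  fun i => ((b * (y i).val : ℕ) : ZMod N)

/-- Length (in fine lattice units) of the straight block-link path from the corner of `y` in direction `μ`: `b`,
except for the LAST block in that direction (`y_μ = T - 1`), whose path has length `N - b (T - 1)` and so absorbs
the remainder of `N` modulo `b` (for `b T ≤ N < b (T + 2)` every length lies in `[b, 3b)`). [folklore] -/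
def unevenLen (b N T : ℕ) (y : Site 4 T) (μ : Fin 4) : ℕ :=
  if (y μ).val + 1 = T then N - b * (T - 1) else b

/-- **Uneven axial block averaging of the gauge field**: the block link `(y, μ)` of the block torus of side `T`
carries the straight-line parallel transporter (tree `transport`) of the fine field from the corner of `y`, of
length `unevenLen b N T y μ` in direction `μ` — Bałaban's axial block link variable (CMP 95 (1984) (1.4)–(1.6); the
tree's `GaugeBlockAveraging.axial`) generalised to fine tori whose side `N` is NOT a multiple of the block factor
(the lattice-gap clause of `QCDOf` ranges over all odd torus sides). Gauge covariant with respect to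
`g ↦ g ∘ unevenCorner`; consecutive paths in one direction tile the fine cycle exactly when `b (T-1) ≤ N`.
[cite: Balaban1984Propagators, §1 (1.4)–(1.7)] -/
def unevenAxialLink [Monoid G] (b N T : ℕ) (U : GaugeConfig 4 N G) : GaugeConfig 4 T G :=
  fun e => transport U (unevenCorner b N T e.1) (List.replicate (unevenLen b N T e.1 e.2) e.2)

/-- The uneven axial blocking is measurable (each block link is an ordered product of coordinate projections).
[folklore] -/
theorem measurable_unevenAxialLink [Group G] [MeasurableSpace G] [MeasurableMul₂ G] (b N T : ℕ) :
    Measurable (unevenAxialLink (G := G) b N T) :=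
  measurable_pi_lambda _ fun _ => measurable_transport _ _

end Blocking

/-- The `SU(3)` fundamental lattice representation as `LatticeRep` data (the instance at which the two
group-general stubs are used by the composition). [folklore] -/
def su3Rep : LatticeRep (Matrix.specialUnitaryGroup (Fin 3) ℂ) :=
  ⟨3, fundamentalRep (Fin 3), continuous_fundamentalRep _, fundamentalRep_injective _,
    fundamentalRep_mem_unitaryGroup⟩

/-! ## §1 The registered stubs (the only `sorry`s of the line) and their packaged statements -/

/-- **CellDobrushinDecay — Dobrushin's comparison with an exponentially WEIGHTED received-sum condition, for a
general specification read through cells (statement of `stub_cellDobrushinDecay`, 3a).** Setting: a finite site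
(link) set `V`, spins `S`, a finite cell index `ι` with a cell map `cell : V → ι`; a specification `γ` (Georgii)
and its single-CELL kernels `γ_{Λ_x}`, `Λ_x = {v | cell v = x}`; influence coefficients `C y x ≥ 0` in the TV /
oscillation form: changing the exterior on ONE cell `y ≠ x` moves the `γ_{Λ_x}`-expectation of every bounded
measurable `f` reading only cell `x` with cell-oscillation `≤ δ` by at most `C y x · δ`. CONCLUSION: for every
Gibbs measure `ν` of `γ`, bounded measurable `f, g` reading the cells `Δf, Δg`, every weight `θ ≥ 0` with `θ ≥ 1`
on `Δg` and every `c₀ < 1` such that off `Δg` the received sums are `≤ c₀` and the WEIGHTED received sums satisfy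
`Σ_y C y x θ y ≤ c₀ θ x`: `|ν(fg) − ν(f)ν(g)| ≤ 8 B_f B_g |Δg| Σ_{x ∈ Δf} θ x`. (Use: `θ x = e^{−t·d(x,Δg)}`;
the weighted condition follows from `Σ_y C y x e^{t·cdist(y,x)} ≤ c₀` by the triangle inequality.) Proof route
(Föllmer 1988 Ch. I §2 in the vector form of the tree's `DobrushinComparisonMetric`, sites ↦ cells): the dusting
estimate `δ_y(T_x F) ≤ δ_y(F) + C y x δ_x(F)`, `δ_x(T_x F) = 0` is the landed `DobrushinShlosman.lip_windowAvg` with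
window `{x}` and the discrete cell weight; estimates `a` (`|E₁F − E₂F| ≤ Σ a_x δ_x`) improve under the simultaneous
update `a ↦ (a C)` on the usable cells `x ∉ Δg` (sweep of `DustingData.IsEstimate.phi`); NEW STEP: with both row
conditions the iterates from the constant vector `1` satisfy `a⁽ⁿ⁾_x ≤ c₀ⁿ + θ_x` (induction: on a usable `x`,
`Σ_y C y x (c₀ⁿ + θ_y) ≤ c₀ⁿ⁺¹ + c₀ θ_x`; on `Δg` the coordinate stays `1 ≤ c₀ⁿ⁺¹ + θ_x`), hence in the limit
`|E₁F − E₂F| ≤ Σ_x θ_x δ_x(F)`; the two states are `ν` (DLR invariance, `IsGibbsMeasure`) and its tilt by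
`g̃ = g − g(τ₀) + Σδ(g) ≥ 0`, invariant under the kernels of cells off `Δg` (properness,
`DobrushinShlosman.mul_windowAvg_eq_of_dependsOn`), and `cov(f,g) = ν(g̃)(ν_{g̃}(f) − ν(f))` as in the landed
`DobrushinShlosman.abs_covariance_le`; oscillations `δ ≤ 2B`. Size M (≈ 400 lines, two thirds adapted from landed
proofs). [cite: Follmer1988, Ch. I Lemma (2.5), Theorem (2.8), Theorem (2.13)] [cite: Kunsch1982]
[cite: Georgii2011, Thm. 8.20, Remark 8.26, §8.2] -/
def CellDobrushinDecay : Prop :=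
  ∀ (ι V S : Type) [Fintype ι] [DecidableEq ι] [Fintype V] [DecidableEq V] [MeasurableSpace S]
    (cell : V → ι) (γ : Literature.Probability.LatticeModels.Specification V S),
    Literature.Probability.LatticeModels.IsSpecification γ →
    ∀ (C : ι → ι → ℝ), (∀ y x, 0 ≤ C y x) →
    (∀ (x y : ι), y ≠ x → ∀ (ω η : V → S), (∀ v, cell v ≠ y → ω v = η v) →
      ∀ (f : (V → S) → ℝ) (δ : ℝ), Measurable f → (∃ B : ℝ, ∀ σ, |f σ| ≤ B) →
        DependsOn f {v | cell v = x} → 0 ≤ δ →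
        (∀ σ τ : V → S, (∀ v, cell v ≠ x → σ v = τ v) → |f σ - f τ| ≤ δ) →
          |(∫ σ, f σ ∂(γ (Finset.univ.filter fun v => cell v = x) ω)) -
              ∫ σ, f σ ∂(γ (Finset.univ.filter fun v => cell v = x) η)| ≤ C y x * δ) →
    ∀ (ν : MeasureTheory.Measure (V → S)), Literature.Probability.LatticeModels.IsGibbsMeasure γ ν →
    ∀ (f g : (V → S) → ℝ) (Δf Δg : Finset ι) (Bf Bg : ℝ),
      Measurable f → Measurable g → (∀ σ, |f σ| ≤ Bf) → (∀ σ, |g σ| ≤ Bg) →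
      DependsOn f {v | cell v ∈ Δf} → DependsOn g {v | cell v ∈ Δg} →
    ∀ (θ : ι → ℝ) (c₀ : ℝ), (∀ x, 0 ≤ θ x) → (∀ x ∈ Δg, 1 ≤ θ x) → 0 ≤ c₀ → c₀ < 1 →
      (∀ x, x ∉ Δg → ∑ y, C y x ≤ c₀) → (∀ x, x ∉ Δg → ∑ y, C y x * θ y ≤ c₀ * θ x) →
        |∫ σ, f σ * g σ ∂ν - (∫ σ, f σ ∂ν) * ∫ σ, g σ ∂ν| ≤ 8 * Bf * Bg * Δg.card * ∑ x ∈ Δf, θ x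

/- stub_cellDobrushinDecay (3a) — LANDED p100468: `Theorems/HeatSlicedQuarksRobustYangMillsHandoverStubCellDobrushinDecay.lean`
(imported; theorem `stub_cellDobrushinDecay` in this namespace, text = `CellDobrushinDecay` unfolded; engine
`Literature/Probability/LatticeModels/DobrushinCellWeightedDecay.lean`, p97400). -/

/-- **CubeInfluence — the one-boundary-cell influence coefficients of the kernels of `μ_{β, D+O}` through cells
of scale `2c`; cube-diagonal `D` is FREE (statement of `stub_cubeInfluence`, 3b).** For every compact group `G`
with lattice representation `r`, cube scale `c ≥ 1`, KP rate `κ > 0`, weight rate `0 ≤ t < κ` and target `ε₀ > 0`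
there are `βs, ηs > 0` such that: for `|β| ≤ βs`, `0 ≤ η ≤ ηs`, every torus `Lt` and frame count `μ` with
`(μ+1)·2c ≤ Lt < (μ+2)·2c` (the explicit product frame `prodFrame Lt (2c) μ` of `ZModTorusFrames`/`BlockCellGeometry`:
cells of `2⁴` blocks, the last cell per axis absorbing the remainder), every CUBE-DIAGONAL `D` (activities only on
single blocks; NO bound on them is needed) and every `O` with `‖O‖_{c,κ} ≤ η` and range control, the kernels
`(D + O).kernel r.ρ β` (`QuasiLocalGaugePerturbationCells`: glued product Haar tilted by `−βS_W − (D+O)`) admit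
influence coefficients `C y x ≥ 0` in the TV/oscillation form of `CellDobrushinDecay` whose exponentially weighted
received sums are small: `Σ_y C y x e^{t·cdist y x} ≤ ε₀` for every cell `x`. Proof route: for cells `x ≠ y` and
exteriors `ω = η` off cell `y`, the two kernels on `Λ_x` are tilts of ONE glued product Haar measure by energies
whose difference, in the glued variables, is (i) `D`-part: ZERO up to a constant (`D_{z}` reads only links based in
block `z`: all in `Λ_x` if `z` is a block of cell `x` — then both exteriors give the same function — or all outside —
then a constant); (ii) Wilson part: a constant unless `cdist x y ≤ 1`, and then of oscillation
`≤ 2|β|·2N·#{plaquettes through Λ_x reading cell y} ≤ A(c)|β|` (`wilsonAction_glueWith_sub_eq`,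
`abs_plaquetteCost_le_of_unitary`, `card_filter_plaquette_le`); (iii) `O`-part: constant up to
`2 Σ_{X ∋ block of x, X reads cell y} ‖O_X‖ ≤ 2·10⁴ η e^{−κ(2·cdist x y − 3)⁺}` by range control
(`exists_abs_total_glueWith_sub_sub_le`, `cdist_cellOf_le_of_blockCorner_near`,
`card_image_blockCorner_le_mul_cellCount`); so `C y x := e^{2a_{yx}} − 1` works by
`integral_glued_tilted_le_exp_mul` (a `[0,1]`-rescaling of `f − inf f`), and
`Σ_y (e^{2a_{yx}} − 1) e^{t·cdist} ≤ 2e^{2a_max} Σ_y a_{yx} e^{t·cdist} ≤ A′(c,N)(|β| + η Σ_d (2d+1)³·8·e^{−(2κ−t)d+3κ})`,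
small for `βs, ηs` small since `t < κ < 2κ`. Size L (≈ 500 lines; the kernel-comparison skeleton is the landed
`integral_kernel_le_exp_mul_of_exterior_eq`, to be re-run with the `D`-part split off and the near-cell Wilson
term kept). [cite: Georgii2011, Ch. 8] [cite: Follmer1988, Ch. I (2.20)] [cite: Balaban1988Convergent, p. 261 (2.42)] -/
def CubeInfluence : Prop :=
  ∀ (G : Type) [Group G] [TopologicalSpace G] [IsTopologicalGroup G] [CompactSpace G]
      [MeasurableSpace G] [BorelSpace G], ∀ (r : LatticeRep G) (c : ℕ) (κ t ε₀ : ℝ),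
    0 < c → 0 < κ → 0 ≤ t → t < κ → 0 < ε₀ →
    ∃ βs : ℝ, 0 < βs ∧ ∃ ηs : ℝ, 0 < ηs ∧ ∀ (β η : ℝ), |β| ≤ βs → 0 ≤ η → η ≤ ηs →
      ∀ (Lt μ : ℕ) [NeZero Lt], (μ + 1) * (2 * c) ≤ Lt → Lt < (μ + 2) * (2 * c) →
      ∀ (D O : QuasiLocalGaugePerturbation 4 Lt G c),
        (∀ X : Finset (Site 4 Lt), X.card ≠ 1 → ∀ V : GaugeConfig 4 Lt G, D.act X V = 0) →
        O.NormLE κ η →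
        (∀ X : Finset (Site 4 Lt), X ∈ polymers c → (∃ U : GaugeConfig 4 Lt G, O.act X U ≠ 0) →
          ∀ y ∈ X, ∀ y' ∈ X, ∀ i : Fin 4, (y i - y' i).val ≤ c * X.card ∨ (y' i - y i).val ≤ c * X.card) →
        ∃ C : Literature.Probability.LatticeModels.CoarseIdx (fun _ : Fin 4 => μ) →
            Literature.Probability.LatticeModels.CoarseIdx (fun _ : Fin 4 => μ) → ℝ,
          (∀ y x, 0 ≤ C y x) ∧
          (∀ x y, y ≠ x → ∀ (ω ζ : GaugeConfig 4 Lt G),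
            (∀ e, cellOf (prodFrame Lt (2 * c) μ) e ≠ y → ω e = ζ e) →
            ∀ (f : GaugeConfig 4 Lt G → ℝ) (δ : ℝ), Measurable f → (∃ B : ℝ, ∀ U, |f U| ≤ B) →
              DependsOn f {e | cellOf (prodFrame Lt (2 * c) μ) e = x} → 0 ≤ δ →
              (∀ U U' : GaugeConfig 4 Lt G,
                (∀ e, cellOf (prodFrame Lt (2 * c) μ) e ≠ x → U e = U' e) → |f U - f U'| ≤ δ) →
              |(∫ U, f U ∂((D + O).kernel r.ρ β
                    (Finset.univ.filter fun e => cellOf (prodFrame Lt (2 * c) μ) e = x) ω)) -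
                  ∫ U, f U ∂((D + O).kernel r.ρ β
                    (Finset.univ.filter fun e => cellOf (prodFrame Lt (2 * c) μ) e = x) ζ)| ≤
                C y x * δ) ∧
          ∀ x, ∑ y, C y x * Real.exp (t * Literature.Probability.LatticeModels.cdist y x) ≤ ε₀

/- stub_cubeInfluence (3b) — LANDED (this seat): `Theorems/HeatSlicedQuarksRobustYangMillsHandoverStubCubeInfluence.lean`
(imported; theorem `stub_cubeInfluence` in this namespace, text = `CubeInfluence` unfolded; engine
`QuasiLocalGaugePerturbationCellInfluence.integral_kernel_cell_le_exp_mul`, p101443). -/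

/-- **CubeClustering — uniform exponential clustering of species observables under `μ_{β, D+O}`: KP-small
inter-cube coupling + small residual plaquette coupling ⇒ clustering, for ANY cube-diagonal self-interaction
(the joint content of the former stubs 3–4, in the true `covCorr` form; conclusion of `stub_clusterDeployment`,
4′; consumed by `massiveLatticeGap_of_stubs`).** For every compact `G`, `r`, cube scale `c ≥ 1` and KP rate
`κ > 0` there are a smallness `εs > 0` and a rate `m > 0` (per block-lattice time unit) such that for all bounded
gauge-invariant cylinder observables `A, B` of `ℤ⁴` there is `C` with: for every `|β| ≤ εs`, every block torus
`2S+1`, every cube-diagonal `D` and every `O` with `‖O‖_{c,κ} ≤ εs` and range control,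
`|covCorr_{β, D+O}(A, B; n)| = |⟨A·τ_nB⟩ − ⟨A⟩⟨τ_nB⟩| ≤ C e^{−mn}` for `n ≤ S`. -/
def CubeClustering : Prop :=
  ∀ (G : Type) [Group G] [TopologicalSpace G] [IsTopologicalGroup G] [CompactSpace G]
      [MeasurableSpace G] [BorelSpace G], ∀ (r : LatticeRep G) (c : ℕ) (κ : ℝ), 0 < c → 0 < κ →
    ∃ εs : ℝ, 0 < εs ∧ ∃ m : ℝ, 0 < m ∧ ∀ A B : YMSpecies G, ∃ Cc : ℝ, ∀ β : ℝ, |β| ≤ εs →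
      ∀ (S : ℕ) (D O : QuasiLocalGaugePerturbation 4 (2 * S + 1) G c),
        (∀ X : Finset (Site 4 (2 * S + 1)), X.card ≠ 1 → ∀ V : GaugeConfig 4 (2 * S + 1) G, D.act X V = 0) →
        O.NormLE κ εs →
        (∀ X : Finset (Site 4 (2 * S + 1)), X ∈ polymers c →
          (∃ U : GaugeConfig 4 (2 * S + 1) G, O.act X U ≠ 0) →
          ∀ y ∈ X, ∀ y' ∈ X, ∀ i : Fin 4, (y i - y' i).val ≤ c * X.card ∨ (y' i - y i).val ≤ c * X.card) →
        ∀ n : ℕ, n ≤ S → |(D + O).covCorr r.ρ β A.F B.F n| ≤ Cc * Real.exp (-(m * n))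

/- stub_clusterDeployment (4′) — LANDED p99520: `Theorems/HeatSlicedQuarksRobustYangMillsHandoverStubClusterDeployment.lean`
(imported; theorem `stub_clusterDeployment : CellDobrushinDecay → CubeInfluence → CubeClustering` with the three
texts unfolded). -/

/-- **CubeClustering is a THEOREM** (3a + 3b + 4′, all landed): KP-small inter-cube coupling and small residual
plaquette coupling give volume-uniform exponential clustering of species covariances under `μ_{β,D+O}` for ANY
cube-diagonal bounded self-interaction `D`, every compact `G`. [folklore] -/
theorem cubeClustering : CubeClustering :=
  stub_clusterDeployment stub_cellDobrushinDecay stub_cubeInfluence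

/-- **stub_twoScaleYM — THE YANG–MILLS-SIDE NAMED CONDITION (HARDEST stub; conditional input of this
conditional-flavour crux): HADRONIC TWO-SCALE DATA IN DOBRUSHIN–KOTECKÝ–PREISS (oscillation) FORM for blocked
`SU(3)` Wilson lattice Yang–Mills along EVERY asymptotically free sequence.** There are a cube size `c ≥ 1`, budgets
`K₁, K₂` and a KP rate `κ > 0` such that for every target smallness `ε > 0` there is `Cℓ > 0` with: for every
lattice scale parameter `Λ' > 0`, every block scale `ℓ₁ ≥ Cℓ/Λ'` (physically: deep enough in the hadronic regime,
`ℓ₁ Λ' ≥ Cℓ(ε)`), every sequence of spacings `a_k → 0` and EVERY coupling sequence `β'` with `N_f = 0` two-loop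
asymptotic scaling at `Λ'` (`β'_k − afBeta 0 Λ' a_k → 0` — β-universality, FINDINGS B2: necessary for every handover
line), EVENTUALLY IN `k` and UNIFORMLY over ALL block tori: for every block torus side `2S''+1` and every fine torus
side `N` in the window `b_k (2S''+1) ≤ N < b_k (2S''+3)`, `b_k = ⌊ℓ₁/a_k⌋` (so that the uneven axial cubes have sides
in `[b_k, 3 b_k)`), the push-forward of the Wilson measure `μ_{N, β'_k}` under `unevenAxialLink b_k N (2S''+1)` IS
the Gibbs measure `(D + O).perturbedMeasure ρ βₑ ∝ exp(−βₑ A(V) − D(V) − O(V)) ∏ dV` on the block torus with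
`|βₑ| ≤ ε` (residual block plaquette coupling small), `D` CUBE-DIAGONAL with `|D_X| ≤ K₁` and `‖D‖_{c,κ} ≤ K₂`
(arbitrary bounded self-interaction of each `c`-cube of block links — NOT small: "diagonal blocks are paid by
oscillation", `K₁` fixed BEFORE `ε`), and `O` with `‖O‖_{c,κ} ≤ ε` AND range control (h4) ("only inter-block
couplings must be small", decaying like `e^{−κ·distance/c}` in block units = `e^{−(κ/(cℓ₁))·distance}` physically).
This is "hadronic disorder" of the renormalisation-group trajectory in a quantitative Dobrushin–KP form: after
blocking past the confinement scale the effective action of the block field is short-ranged and weak BETWEEN cubes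
(Wilson's strong-coupling picture of the IR fixed point; MCRG lore), uniformly in the volume. It is STRONGER than
`YMLatticeGapAlongAFSequences` (8796; it implies it via stubs 3–4 and a YM-only version of stub 6) and of
complete-analyticity strength at one hadronic scale (triage cross-note 2), DIFFERENT IN KIND from `RobustYangMills`
(13897): no admissibility cone, no OS/E1/non-Gaussianity clause, no openness postulated — openness is stub 3.
Why it might fail (the bet): (a) it contains the `SU(3)` weak-coupling lattice mass gap and its β-universality
(`PerturbativeInvisibility`: invisible to any expansion in `g`); (b) the representation is demanded POINTWISE over
ALL block fields with sup-norm (oscillation) control — a slow/rare block-field mode surviving at hadronic scales on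
symmetric tori (e.g. a topological block observable with `k`-growing autocorrelation) would falsify the uniform
Dobrushin smallness; known topological freezing is a CUTOFF-scale phenomenon living in the fibre, not in the block
marginal (card, cheapest falsifier (ii)); (c) `S'' = 0` is included: the law of the four Polyakov holonomies of a
symmetric fine torus of side `∈ [ℓ₁, 3ℓ₁)` must have `−log`-density bounded by `K₁` uniformly — consistent with
unbroken centre symmetry on SYMMETRIC tori (barriers `CenterSymmetryBreakingByQuarks`/`FiniteTemperatureDeconfinement`
concern asymmetric, thermal geometries). Refutable cheaply in part: `kit` numerics of the card's falsifier (i)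
(conditional covariance of adjacent BLOCK plaquettes given all other block links at `b a ≈ 0.5, 1 fm`, `SU(2)`
proxy) test the inter-cube smallness. Degenerate checks: `b_k = 0` (early `k`) empties the window; the identity pins
`(βₑ, D, O)` only through the total density, so the splitting freedom is the prover's; representability of the
blocked density in D1's class at each FIXED `(k, S'', N)` is automatic (positive continuous density on a compact
space; lump into one polymer) — the content is the UNIFORMITY of `(K₁, K₂, κ, ε)` in `k`, `S''`, `N`, `β'`.
Size: open-problem (a theory). Leans on: tree `wilsonMeasure`, `afBeta`, `fundamentalRep`,
`QuasiLocalGaugePerturbation.{act, NormLE, perturbedMeasure}`, `polymers`, Mathlib `Measure.map`; §0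
`unevenAxialLink`. Sources: Wilson's block-spin RG / strong-coupling fixed point; Bałaban's effective-action format;
Dobrushin–Shlosman complete analyticity; the β-universality item 8796 and FINDINGS B2/B4.
[cite: JaffeWitten2000, §5] [cite: Balaban1988Convergent, §2 (2.25)–(2.42)] [cite: DobrushinShlosman1987]
[cite: Creutz2022] [cite: BauerschmidtBodineauDagallier2024] -/
theorem stub_twoScaleYM :
    ∃ (c : ℕ) (K₁ K₂ κ : ℝ), 0 < c ∧ 0 < κ ∧ ∀ ε : ℝ, 0 < ε → ∃ Cℓ : ℝ, 0 < Cℓ ∧ ∀ Λ' : ℝ, 0 < Λ' →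
      ∀ ℓ₁ : ℝ, Cℓ / Λ' ≤ ℓ₁ → ∀ (a : ℕ → ℝ), (∀ k, 0 < a k) → Tendsto a atTop (𝓝 0) →
      ∀ β' : ℕ → ℝ, Tendsto (fun k => β' k - afBeta 0 Λ' (a k)) atTop (𝓝 0) →
      ∀ᶠ k in atTop, ∀ (S'' N : ℕ) [NeZero N],
        ⌊ℓ₁ / a k⌋₊ * (2 * S'' + 1) ≤ N → N < ⌊ℓ₁ / a k⌋₊ * (2 * S'' + 3) →
        ∃ (βe : ℝ) (D O : QuasiLocalGaugePerturbation 4 (2 * S'' + 1) (Matrix.specialUnitaryGroup (Fin 3) ℂ) c),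
          |βe| ≤ ε ∧
          (∀ X : Finset (Site 4 (2 * S'' + 1)), X.card ≠ 1 →
            ∀ V : GaugeConfig 4 (2 * S'' + 1) (Matrix.specialUnitaryGroup (Fin 3) ℂ), D.act X V = 0) ∧
          (∀ (X : Finset (Site 4 (2 * S'' + 1)))
            (V : GaugeConfig 4 (2 * S'' + 1) (Matrix.specialUnitaryGroup (Fin 3) ℂ)), |D.act X V| ≤ K₁) ∧
          D.NormLE κ K₂ ∧ O.NormLE κ ε ∧
          (∀ X : Finset (Site 4 (2 * S'' + 1)), X ∈ polymers c →
            (∃ U : GaugeConfig 4 (2 * S'' + 1) (Matrix.specialUnitaryGroup (Fin 3) ℂ), O.act X U ≠ 0) →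
            ∀ y ∈ X, ∀ y' ∈ X, ∀ i : Fin 4, (y i - y' i).val ≤ c * X.card ∨ (y' i - y i).val ≤ c * X.card) ∧
          (wilsonMeasure (d := 4) (L := N) (fundamentalRep (Fin 3)) (β' k)).map
              (unevenAxialLink ⌊ℓ₁ / a k⌋₊ N (2 * S'' + 1)) =
            (D + O).perturbedMeasure (fundamentalRep (Fin 3)) βe := by
  sorry

/-- **stub_heavyQuarkBlockRemainder — FERMIONIC RE-ENTRY I: above the threshold the blocked SIGNED lattice-QCD
weight is a constant multiple of `e^{−W'} ×` the blocked Wilson weight at a MATCHED a.f. coupling, `W'` KP-small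
with range control (cards proper-time-residual-determinant + rao-blackwell-sign folded in; triage 3 (i)–(ii)
honoured: sizes from the BLOCK operator, positivity demanded for `N_f = 2` AND `3`).** For `N_f ∈ {2, 3}` and every
X₀-HONEST regularisation `reg` (hypothesis = the `∃ reg`-body of `ContinuumQCDExists` INCLUDING the three
non-triviality clauses — Disproof §2 honoured here) there is `Λs > 0` (a lower bound for the matched pure-gauge scale
parameters above mass `1`) such that for all `ℓ₁ > 0`, `κ > 0`, `c ≥ 1`, `ε' > 0` there is a threshold `M₅` with:
for every mass tuple `m > M₅` there are a MATCHED coupling sequence `β'` and `Λ' ≥ Λs` with `N_f = 0` asymptotic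
scaling (`β'_k − afBeta 0 Λ' a_k → 0`: the one-loop heavy-threshold log + two-loop log-log of `CouplingMatching`,
stmt-8797 — Disproof §9(i): the DIVERGENT marginal shift lives in `β' − β`, never in `W'`) such that eventually in
`k`, for every block torus `2S''+1` and fine torus `N` in the window, there are a block-scale quasi-local `W'` at cube
scale `c` with `‖W'‖_{c,κ} ≤ ε'` and range control, and a REAL CONSTANT `Z ≠ 0`, with, for every measurable set `E`
of block fields: `∫_{Φ⁻¹E} (∫dψ̄dψ e^{−ψ̄ D(U) ψ}) dμ_{N,β_k}(U) = Z · ∫_{Φ⁻¹E} e^{−W'(Φ U)} dμ_{N,β'_k}(U)`,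
`Φ = unevenAxialLink b_k N (2S''+1)`, `D(U)` the `N_f`-flavour Wilson–Dirac operator at the scheme's OWN bare masses
`m_crit(k) + a_k m_f/Z_m(k)` (tree `fermiIntegral ∘ fermiBoltzmann`, exactly the signed unquenched weight of
`qcdTorusExpect`). CONTENT: (a) POSITIVITY of the fibre-averaged signed weight (`Z ≠ 0` real and a positive
integrand on the right force a constant sign of the blocked complex measure — rao-blackwell-sign in its a.e. form,
load-bearing for BOTH conjuncts since `QCDOf 2` ranges over split masses (barriers `WilsonDeterminantSign`,
`WilsonDeterminantMassSplitting` are configuration-wise and do not speak about fibre averages); `Z` may be negative: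
the Berezin orientation sign depends on the number of quark variables); (b) QuarkRemainderSmall in SUP KP norm over
ALL block fields, rough ones included: relative to blocked Yang–Mills at the matched coupling, `−log` of the ratio
of blocked densities is a sum of cube-local terms of size `O(N_f (ℓ₁ M₀)^{−2})` after β-matching (dimension-6
irrelevant operators, Symanzik/Appelquist–Carazzone — triage 1/3: POWER-small, not `e^{−(ℓ₁M₀)²}`) plus inter-cube
terms `O(e^{−c M₀ ℓ₁·distance})`, hence `≤ ε'` above a threshold `M₅(ℓ₁, κ, c, ε', reg)`; (c) HONEST SCOPE — this
stub CONTAINS, besides the a.f.-scale block integration of heavy Wilson quarks (engine-grade: coercive BLOCK Dirac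
operator at scale `c_q/M₀`, convergent covariant hopping/polymer expansion conditional on the block field; never the
fine operator, Disproof §9(ii)/§10), the CROSSOVER TRANSPORT of the resulting small perturbation from `c_q/M₀` to the
hadronic scale `ℓ₁` in sup-KP norm (FINDINGS B4, triage 2): a comparison of blocked QCD and blocked matched-YM
densities at a hadronic scale, pointwise in the block field — a stability statement through the crossover that
`stub_twoScaleYM` (which is `W`-free) does NOT supply. Reshape option for the lead: split into S5q (engine-side
handover at `c_q/M₀` in D1′ format, `HasBlockScaleEffectivePerturbation`) and S5t (YM-side Lipschitz transport
`c_q/M₀ → ℓ₁` of small D1′ perturbations into the sup-KP class), at the price of a seventh stub and of postulating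
transport-level robustness. Why it might fail: the crossover transport (c); exceptional block fields where the block
Dirac operator loses coercivity (low-mode-quarantine / band-limited-payload are the recorded repair formats); a
positive-measure set of block fields with negative fibre average at `N_f = 3` (the card's 2D two-flavour toy is the
cheap test, not run). Degenerate checks: `b_k = 0` empties the window; `z = shift = 0` in the bare masses is no loss
(`hasLatticeMassGap_scheme_indep`); honesty excludes `canonicalAF`. Size: XL (L without (c)). Leans on: tree
`fermiIntegral`, `fermiBoltzmann`, `QCDRegularisation.scheme`, `wilsonMeasure`, `afBeta`,
`QuasiLocalGaugePerturbation.{NormLE, act, total}`, `polymers`, items `CouplingMatching` 8797 (provable-now),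
`WilsonFermionBlockAveraging` (D2), `BlockScaleEffectivePerturbation` (D1′), `QCDHeavyQuarkPropagator`; §0
`unevenAxialLink`. [cite: AppelquistCarazzone1975] [cite: BrunoEtAl2015HeavySea] [cite: Balaban1988Convergent]
[cite: BalabanOcarrollSchor1989] [cite: MontvayMunster1994, §5.1] [cite: Luscher1977] -/
theorem stub_heavyQuarkBlockRemainder :
    ∀ Nf : ℕ, Nf = 2 ∨ Nf = 3 → ∀ reg : QCDRegularisation Nf,
      (reg.HasMassScaling ∧ ∀ m : Fin Nf → ℝ, (∀ f, 0 < m f) →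
        ∃ (z shift : QCDField Nf → ℕ → ℝ) (T : OSData (QCDField Nf) 4),
          IsQCDAlong (reg.scheme m z shift) T ∧ T.IsNontrivial QCDField.glue ∧ T.IsNonGaussian QCDField.glue ∧
            ∀ f g : Fin Nf, f ≠ g → T.IsNontrivial (QCDField.pseudoRe f g)) →
      ∃ Λs : ℝ, 0 < Λs ∧ ∀ (ℓ₁ κ : ℝ) (c : ℕ) (ε' : ℝ), 0 < ℓ₁ → 0 < κ → 0 < c → 0 < ε' →
        ∃ M₅ : ℝ, ∀ m : Fin Nf → ℝ, (∀ f, M₅ < m f) →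
          ∃ (β' : ℕ → ℝ) (Λ' : ℝ), Λs ≤ Λ' ∧
            Tendsto (fun k => β' k - afBeta 0 Λ' (reg.a k)) atTop (𝓝 0) ∧
            ∀ᶠ k in atTop, ∀ (S'' N : ℕ) [NeZero N],
              ⌊ℓ₁ / reg.a k⌋₊ * (2 * S'' + 1) ≤ N → N < ⌊ℓ₁ / reg.a k⌋₊ * (2 * S'' + 3) →
              ∃ (W' : QuasiLocalGaugePerturbation 4 (2 * S'' + 1) (Matrix.specialUnitaryGroup (Fin 3) ℂ) c)
                (Z : ℝ), W'.NormLE κ ε' ∧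
                (∀ X : Finset (Site 4 (2 * S'' + 1)), X ∈ polymers c →
                  (∃ U : GaugeConfig 4 (2 * S'' + 1) (Matrix.specialUnitaryGroup (Fin 3) ℂ), W'.act X U ≠ 0) →
                  ∀ y ∈ X, ∀ y' ∈ X, ∀ i : Fin 4,
                    (y i - y' i).val ≤ c * X.card ∨ (y' i - y i).val ≤ c * X.card) ∧
                Z ≠ 0 ∧
                ∀ E : Set (GaugeConfig 4 (2 * S'' + 1) (Matrix.specialUnitaryGroup (Fin 3) ℂ)), MeasurableSet E →
                  ∫ U in (unevenAxialLink ⌊ℓ₁ / reg.a k⌋₊ N (2 * S'' + 1)) ⁻¹' E,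
                      fermiIntegral (fermiBoltzmann U fun f => (reg.scheme m 0 0).mq f k)
                    ∂(wilsonMeasure (d := 4) (L := N) (fundamentalRep (Fin 3)) (reg.β k)) =
                  (Z : ℂ) * ((∫ U in (unevenAxialLink ⌊ℓ₁ / reg.a k⌋₊ N (2 * S'' + 1)) ⁻¹' E,
                      Real.exp (-(W'.total (unevenAxialLink ⌊ℓ₁ / reg.a k⌋₊ N (2 * S'' + 1) U)))
                    ∂(wilsonMeasure (d := 4) (L := N) (fundamentalRep (Fin 3)) (β' k)) : ℝ) : ℂ) := by
  sorry

/-- **stub_fineFromBlockCS — FERMIONIC RE-ENTRY II + TRANSFER (RESHAPE r2: conclusion now ALSO carries the species Cauchy–Schwarz clustering clause `HasSpeciesCSClustering` at the same rate for every species renormalisation `(z, shift)` — the clause the landed Literature transfer `IsQCDAlong.hasMassGap_of_hasSpeciesCSClustering` reads the continuum gap off; it is what mechanism (G) below, the fixed-cutoff transfer-matrix spectral statement on the charge-zero sector, delivers for the smeared species fields, which live in that sector): block representation + UNIFORM block clustering ⇒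
the full-spectrum lattice gap clause for ALL fine lattice-QCD observables, above the threshold.** For
`N_f ∈ {2, 3}`, every HONEST `reg` (Disproof §2 honoured again: the threshold is physical only for honest
calibrations), every block scale `ℓ₁ > 0`, cube size `c ≥ 1` and block rate `mr > 0` there is a threshold `M₆`
with: for every mass tuple `m > M₆` and every coupling sequence `β'`, IF there is a constant map
`C : (A, B) ↦ C_{AB}` such that eventually in `k`, for every block torus `2S''+1` and fine torus `N` in the window,
some `(βₑ, D, O, W', Z ≠ 0)` satisfy (i) the blocked Wilson measure at `β'_k` is `(D + O).perturbedMeasure ρ βₑ`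
(stub 2's shape), (ii) the blocked signed QCD weight of `reg.scheme m 0 0` at step `k` is `Z · e^{−W'} ×` the
Wilson weight at `β'_k` (stub 5's shape) — so that the normalised blocked QCD measure IS
`(D + O + W').perturbedMeasure ρ βₑ` and block observables `B ∘ Φ` have QCD expectations equal to its expectations —
and (iii) ALL bounded gauge-invariant block-cylinder observables cluster under it at rate `mr` per block-time unit
with prefactors `C_{AB}` (4′'s shape; RESHAPE r1: the genuine covariance `covCorr` — `⟨A·τ_nB⟩ − ⟨A⟩⟨τ_nB⟩` — since
the blocked measure is not translation invariant; on the FINE torus of the conclusion the two notions agree), THEN `(reg.scheme m 0 0).HasLatticeMassGap (mr/(4ℓ₁))`: every pair of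
gauge-invariant local lattice-QCD observables (Wilson loops, mesons, baryons, quark boxes `R, R'`) has connected
Euclidean-time correlations `≤ C e^{−(mr/(4ℓ₁)) a_k n}` on every torus `2S+1 ≥ 2L_k+1`, `n ≤ S`, eventually in `k`
(rate bookkeeping: cube sides `< 3 b_k` and `b_k a_k ≤ ℓ₁` give `≥ mr a_k/(3ℓ₁)` per fine time unit, the remaining
slack is for the transfer; tori `2S+1 ≥ 2L_k+1 ≥ b_k` are covered by the windows eventually since `a_k L_k → ∞`).
CONTENT — two mechanisms, both at FIXED cutoff (no Yang–Mills-strength input is hidden here):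
(G) GLUONIC / flavour-neutral channels: block observables `B ∘ Φ` are special fine observables; at fixed `k` (all
volumes), Lüscher–Osterwalder–Seiler positivity gives the transfer matrix `𝕋_k` (its range `κ_f(k) < 1/6` holds
eventually for every honest `reg`: sorry-free `fineHopping_lt_sixth_of_honest` in §2, from the landed
`Negative.HoppingWindow`, Disproof §12(A)); uniform block clustering for ALL
block cylinder observables at ALL block times puts the spectral measures of the vectors `M_{B₁}𝕋^{b}M_{B₂}⋯Ω` off
`(0, Δ)`; the fixed-cutoff CYCLICITY LEMMA — these vectors are dense in the charge-zero sector (the dynamics `𝕋^b`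
separates the `b³` Brillouin sub-zone components of a fine excitation by their distinct energies; checked on the
free field, where block form factors vanish only on null sets and Vandermonde in `e^{−ω(p + 2πj/b) b n}` does the
rest) — then gives `P_{(0,Δ)} = 0` on that sector and fine clustering with constants `‖A‖∞‖B‖∞`, UNIFORM in `k`;
the finite symmetric torus (twisted trace, `n ≤ S`) is handled as in `GapTransfer`'s gaps G1–G2 (thermal
corrections `O(volume · e^{−Δ a (2S+1)})`). ALTERNATIVE for (G), recorded not chosen: V-uniform decorrelation of the
fine field given the block field (FibreMixing) — triage 2 showed it is hadronic-scale YM-strength content and it is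
NOT robust under the quark weight, so it is deliberately NOT a hypothesis here; a prover who needs it must ask the
lead for a reshape adding `FibreMixing(ℓ₁)` to stub 2 (weakening the line). (Q) FLAVOURED / baryonic channels and
quark-carrying observables: heavy QUARK LINES at the block scale — the Berezin integral of `A · e^{−ψ̄Dψ}` is
`det D ×` contractions with propagators; above the threshold lines of physical length `ℓ` weigh `≤ e^{−c M₀ ℓ}`
after blocking (coercive block operator, `HeavyBlockIntegration`-type; NOT the fine operator, whose bare mass is
eventually negative — Disproof §9(ii)), so charged sectors are gapped at rate `≍ M₀ ≫ mr/(4ℓ₁)` once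
`M₆ = M₆(ℓ₁, mr, reg)` is large. Why it might fail: (G) the cyclicity lemma is new (plausible, unproved; its failure
mode would be a conserved fibre structure commuting with `𝕋^b`, which Wilson's action does not have); the
finite-torus thermal bookkeeping with volume-uniform constants; (Q) block-scale coercivity on exceptional block
fields (low-mode-quarantine's budget `ActionBoundsLowModes` 8872 is the recorded repair). Degenerate checks: the
witnesses `(βₑ, D, O, W', Z)` may depend on `(k, S'', N)` but the MEASURE they define is pinned by (i)–(ii), so (iii)
is witness-independent; without the threshold/honesty the statement would be FALSE (light pions in flavoured
channels are invisible to gluonic block observables) — hence `∃ M₆` after an honest `reg`. Size: XL. Leans on: tree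
`QCDScheme.HasLatticeMassGap`, `qcdLatticeConnectedCorr`, `qcdTorusExpect`, `QCDLatticeObservable`, `fermiIntegral`,
`fermiBoltzmann`, `wilsonMeasure`, `QuasiLocalGaugePerturbation.{perturbedMeasure, connectedCorr}`, `YMSpecies`,
`QCDTransferMatrix`/`QCDSlab` files (Lüscher positivity), §0 `unevenAxialLink`.
[cite: Luscher1977] [cite: OsterwalderSeiler1978, §§2–4] [cite: Seiler1982, Ch. 3]
[cite: MontvayMunster1994, §5.1] [cite: DobrushinShlosman1987] -/
theorem stub_fineFromBlockCS :
    ∀ Nf : ℕ, Nf = 2 ∨ Nf = 3 → ∀ reg : QCDRegularisation Nf,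
      (reg.HasMassScaling ∧ ∀ m : Fin Nf → ℝ, (∀ f, 0 < m f) →
        ∃ (z shift : QCDField Nf → ℕ → ℝ) (T : OSData (QCDField Nf) 4),
          IsQCDAlong (reg.scheme m z shift) T ∧ T.IsNontrivial QCDField.glue ∧ T.IsNonGaussian QCDField.glue ∧
            ∀ f g : Fin Nf, f ≠ g → T.IsNontrivial (QCDField.pseudoRe f g)) →
      ∀ (ℓ₁ : ℝ) (c : ℕ) (mr : ℝ), 0 < ℓ₁ → 0 < c → 0 < mr →
        ∃ M₆ : ℝ, ∀ m : Fin Nf → ℝ, (∀ f, M₆ < m f) → ∀ β' : ℕ → ℝ,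
          (∃ C : YMSpecies (Matrix.specialUnitaryGroup (Fin 3) ℂ) →
              YMSpecies (Matrix.specialUnitaryGroup (Fin 3) ℂ) → ℝ,
            ∀ᶠ k in atTop, ∀ (S'' N : ℕ) [NeZero N],
              ⌊ℓ₁ / reg.a k⌋₊ * (2 * S'' + 1) ≤ N → N < ⌊ℓ₁ / reg.a k⌋₊ * (2 * S'' + 3) →
              ∃ (βe : ℝ) (D O W' : QuasiLocalGaugePerturbation 4 (2 * S'' + 1)
                  (Matrix.specialUnitaryGroup (Fin 3) ℂ) c) (Z : ℝ),
                Z ≠ 0 ∧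
                (wilsonMeasure (d := 4) (L := N) (fundamentalRep (Fin 3)) (β' k)).map
                    (unevenAxialLink ⌊ℓ₁ / reg.a k⌋₊ N (2 * S'' + 1)) =
                  (D + O).perturbedMeasure (fundamentalRep (Fin 3)) βe ∧
                (∀ E : Set (GaugeConfig 4 (2 * S'' + 1) (Matrix.specialUnitaryGroup (Fin 3) ℂ)), MeasurableSet E →
                  ∫ U in (unevenAxialLink ⌊ℓ₁ / reg.a k⌋₊ N (2 * S'' + 1)) ⁻¹' E,
                      fermiIntegral (fermiBoltzmann U fun f => (reg.scheme m 0 0).mq f k)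
                    ∂(wilsonMeasure (d := 4) (L := N) (fundamentalRep (Fin 3)) (reg.β k)) =
                  (Z : ℂ) * ((∫ U in (unevenAxialLink ⌊ℓ₁ / reg.a k⌋₊ N (2 * S'' + 1)) ⁻¹' E,
                      Real.exp (-(W'.total (unevenAxialLink ⌊ℓ₁ / reg.a k⌋₊ N (2 * S'' + 1) U)))
                    ∂(wilsonMeasure (d := 4) (L := N) (fundamentalRep (Fin 3)) (β' k)) : ℝ) : ℂ)) ∧
                ∀ (A B : YMSpecies (Matrix.specialUnitaryGroup (Fin 3) ℂ)) (n : ℕ), n ≤ S'' →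
                  |(D + O + W').covCorr (fundamentalRep (Fin 3)) βe A.F B.F n| ≤
                    C A B * Real.exp (-(mr * n))) →
          (reg.scheme m 0 0).HasLatticeMassGap (mr / (4 * ℓ₁)) ∧
            ∀ z shift : QCDField Nf → ℕ → ℝ,
              (reg.scheme m z shift).HasSpeciesCSClustering (mr / (4 * ℓ₁)) := by
  sorry

/-- **The pre-re-type conjunct in threshold form** (verbatim the RHS of the former `qcdOf_iff_threshold`; also
`Cruxes/RobustYangMillsHandover/RetypeImpact.lean`): honest data and BOTH gap clauses above an unpinned common offset
`M₀ ≥ 0` of ONE mass-independent regularisation.  The strongest statement a heavy-quark handover reaches; implied by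
the re-typed `QCDOf` (`M₀ = 0`), no longer implying it. [folklore] -/
def QCDOfAboveThreshold (Nf : ℕ) : Prop :=
  ∃ M₀ : ℝ, 0 ≤ M₀ ∧ ∃ reg : QCDRegularisation Nf,
    reg.HasMassScaling ∧ ∀ m : Fin Nf → ℝ, (∀ f, M₀ < m f) →
      ∃ (z shift : QCDField Nf → ℕ → ℝ) (T : OSData (QCDField Nf) 4),
        IsQCDAlong (reg.scheme m z shift) T ∧ T.IsNontrivial QCDField.glue ∧ T.IsNonGaussian QCDField.glue ∧
          (∀ f g : Fin Nf, f ≠ g → T.IsNontrivial (QCDField.pseudoRe f g)) ∧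
            ∃ Δ > 0, T.HasMassGap Δ ∧ (reg.scheme m z shift).HasLatticeMassGap Δ

/-- **stub_chiralCompletion — THE LIGHT-QUARK COMPLETION (open; CRUX-SIZED; the NEW content the statement re-type
p117723 placed inside this crux; NOT this line's mechanism).**  From the heavy-regime conjunct for both flavour
numbers (`QCDOfAboveThreshold 2 ∧ 3`: one regularisation per `N_f` with honest data and both gap clauses at all mass
tuples above an unpinned offset `M₀`) to the re-typed `QCD`: a regularisation that is CHIRAL AT ZERO
(`reg.IsChiralAtZero`: arbitrarily small lattice gaps at positive tuples) AND carries honest data with both gap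
clauses at EVERY positive tuple.  CONTENT: locate the chiral point `M⋆` of the heavy-regime regularisation's bare
trajectory (pion mass → 0; Goldstone: the lattice gap closes there and only there), shift `m_crit` by `a M⋆/Z_m`,
and supply, for all tuples between `M⋆` and `M₀`, (i) continuum existence with the three non-triviality clauses
(X₀ is silent there whenever its own offset sits above `M⋆`), (ii) the volume-uniform lattice gap and the continuum
gap down to — but excluding — the chiral point, (iii) gaplessness AT the chiral point in the `IsChiralAtZero` form.
This is light-quark QCD (few-light-flavour massive lattice gap, chiral perturbation theory regime) — as hard as the
summit conjunct itself minus the heavy regime; immune to junk by form (`¬stub ↔ hypothesis ∧ ¬QCD`).  WHY IT IS HERE: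
so that `RobustYangMillsHandover_of` still concludes the crux BY NAME against the re-typed statement and the census
names exactly what is missing; the lead's release note asks the planner to PROMOTE it (new crux `ChiralCompletion`)
and to restate this crux's target as `ContinuumQCDExists → QCDOfAboveThreshold 2 ∧ QCDOfAboveThreshold 3`.
Size: open-problem. [cite: JaffeWitten2000, §5] [cite: MontvayMunster1994, §5.1 (5.82)–(5.91)] -/
theorem stub_chiralCompletion :
    (∀ Nf : ℕ, Nf = 2 ∨ Nf = 3 → QCDOfAboveThreshold Nf) → _root_.QCD := by
  sorry

/-! ## §2 Sorry-free glue: Lüscher's range along honest trajectories, range control of sums, and the mechanism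
stubs ⇒ the lattice half with species clustering ⇒ `MassiveLatticeGap` (8922) -/

/-- **Disproof §12(A), USED — the fixed-cutoff transfer matrix of `stub_fineFromBlock` (G) lives in Lüscher's
positivity range.** For an X₀-honest `reg` (the hypothesis of stubs 5–6), every mass tuple `m > 0` and every
flavour `f`, the FINE Wilson hopping parameter `κ_f(k) = 1/(2 m_f(k) + 8)` of the scheme `reg.scheme m 0 0` (the
scheme stubs 5–6 speak about; its bare masses do not read `z, shift`) is eventually `< 1/6`, i.e. `m_f(k) > −1`
(physical-branch clause of `IsQCDAlong`), the range in which the Wilson-fermion transfer matrix is positive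
(Lüscher 1977; Montvay–Münster (4.111)) — via the LANDED `Negative.hoppingParam_lt_sixth_iff` (HoppingWindow.lean).
The complementary lower edge `κ_f(k) > 1/8` (`Negative.scheme_hoppingParam_window`, one-loop-deep `m_crit`) is the
reason no stub expands the fine operator in the hopping parameter. [cite: Luscher1977]
[cite: MontvayMunster1994, §4.2.3 (4.111)] -/
theorem fineHopping_lt_sixth_of_honest {Nf : ℕ} (reg : QCDRegularisation Nf)
    (hreg : reg.HasMassScaling ∧ ∀ m : Fin Nf → ℝ, (∀ f, 0 < m f) →
      ∃ (z shift : QCDField Nf → ℕ → ℝ) (T : OSData (QCDField Nf) 4),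
        IsQCDAlong (reg.scheme m z shift) T ∧ T.IsNontrivial QCDField.glue ∧ T.IsNonGaussian QCDField.glue ∧
          ∀ f g : Fin Nf, f ≠ g → T.IsNontrivial (QCDField.pseudoRe f g))
    (m : Fin Nf → ℝ) (hm : ∀ f, 0 < m f) (f : Fin Nf) :
    ∀ᶠ k in atTop, 1 / (2 * (reg.scheme m 0 0).mq f k + 8) < (1 : ℝ) / 6 := by
  obtain ⟨z, shift, T, hA, -, -, -⟩ := hreg.2 m hm
  have hbranch : ∀ᶠ k in atTop, -1 < (reg.scheme m z shift).mq f k := hA.2.1 f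
  filter_upwards [hbranch] with k hk
  have hmq : (reg.scheme m 0 0).mq f k = (reg.scheme m z shift).mq f k := rfl
  rw [hmq]
  have h8 : 0 < 2 * (reg.scheme m z shift).mq f k + 8 := by linarith
  exact (Summit.QuantumFields.QCD.Theorems.RobustYangMillsHandover.Negative.hoppingParam_lt_sixth_iff h8).2 hk

/-- Range control of the sum of two range-controlled perturbations (an activity-carrying polymer of the sum
carries an activity of one summand). [folklore] -/
theorem rangeControl_add2 {S c : ℕ} {G : Type*} [Group G] [MeasurableSpace G]
    (O W : QuasiLocalGaugePerturbation 4 (2 * S + 1) G c)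
    (hO : ∀ X : Finset (Site 4 (2 * S + 1)), X ∈ polymers c →
      (∃ U : GaugeConfig 4 (2 * S + 1) G, O.act X U ≠ 0) →
      ∀ y ∈ X, ∀ y' ∈ X, ∀ i : Fin 4, (y i - y' i).val ≤ c * X.card ∨ (y' i - y i).val ≤ c * X.card)
    (hW : ∀ X : Finset (Site 4 (2 * S + 1)), X ∈ polymers c →
      (∃ U : GaugeConfig 4 (2 * S + 1) G, W.act X U ≠ 0) →
      ∀ y ∈ X, ∀ y' ∈ X, ∀ i : Fin 4, (y i - y' i).val ≤ c * X.card ∨ (y' i - y i).val ≤ c * X.card) :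
    ∀ X : Finset (Site 4 (2 * S + 1)), X ∈ polymers c →
      (∃ U : GaugeConfig 4 (2 * S + 1) G, (O + W).act X U ≠ 0) →
      ∀ y ∈ X, ∀ y' ∈ X, ∀ i : Fin 4, (y i - y' i).val ≤ c * X.card ∨ (y' i - y i).val ≤ c * X.card := by
  intro X hX hU y hy y' hy' i
  obtain ⟨U, hU⟩ := hU
  simp only [QuasiLocalGaugePerturbation.add_act] at hU
  by_cases hO0 : O.act X U = 0
  · have hW0 : W.act X U ≠ 0 := by
      intro h
      apply hU
      rw [hO0, h]
      simp
    exact hW X hX ⟨U, hW0⟩ y hy y' hy' i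
  · exact hO X hX ⟨U, hO0⟩ y hy y' hy' i

/-- **The mechanism stubs prove the lattice half WITH the species clustering clause, above a threshold, for every
honest regularisation** (RESHAPE r2 of the composition; constants compose WITHOUT circularity, exactly as in gen 3):
Yang–Mills fixes `(c, K₁, K₂, κ)` (stub 2); `cubeClustering` (3a+3b+4′, landed) turns `(c, κ)` into the smallness `εs`
and the rate `mr` per block with per-pair prefactors; Yang–Mills is asked for `εs/2`, giving `Cℓ`; honesty gives
`Λs` (stub 5), whence `ℓ₁ := Cℓ/Λs`; thresholds `M₅(ℓ₁, κ, c, εs/2)` (stub 5) and `M₆(ℓ₁, c, mr)` (stub 6) give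
`M := max M₅ M₆`; for `m > M` stub 5 supplies the matched `β'`, `Λ' ≥ Λs`, and eventually in `k` the data
`(βₑ, D, O)` and the remainder `(W', Z)`; ROBUSTNESS IS THE TRIANGLE INEQUALITY `‖O + W'‖_{c,κ} ≤ εs/2 + εs/2`
(`NormLE.add`) feeding `cubeClustering` at `(D, O + W')` with `rangeControl_add2`; stub 6 converts the uniform block
clustering into `HasLatticeMassGap (mr/(4ℓ₁))` AND the species clustering for every `(z, shift)`. [folklore] -/
theorem latticeGappedCS_of_stubs :
    ∀ Nf : ℕ, Nf = 2 ∨ Nf = 3 → ∀ reg : QCDRegularisation Nf,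
      (reg.HasMassScaling ∧ ∀ m : Fin Nf → ℝ, (∀ f, 0 < m f) →
        ∃ (z shift : QCDField Nf → ℕ → ℝ) (T : OSData (QCDField Nf) 4),
          IsQCDAlong (reg.scheme m z shift) T ∧ T.IsNontrivial QCDField.glue ∧ T.IsNonGaussian QCDField.glue ∧
            ∀ f g : Fin Nf, f ≠ g → T.IsNontrivial (QCDField.pseudoRe f g)) →
      ∃ M : ℝ, ∀ m : Fin Nf → ℝ, (∀ f, M < m f) → ∃ Δ : ℝ, 0 < Δ ∧
        (reg.scheme m 0 0).HasLatticeMassGap Δ ∧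
          ∀ z shift : QCDField Nf → ℕ → ℝ, (reg.scheme m z shift).HasSpeciesCSClustering Δ := by
  intro Nf hNf reg hreg
  obtain ⟨c, K₁, K₂, κ, hc, hκ, hYM⟩ := stub_twoScaleYM
  obtain ⟨εs, hεs, mr, hmr, hclus⟩ := cubeClustering (Matrix.specialUnitaryGroup (Fin 3) ℂ) su3Rep c κ hc hκ
  obtain ⟨Cℓ, hCℓ, hdata⟩ := hYM (εs / 2) (half_pos hεs)
  obtain ⟨Λs, hΛs, hquark⟩ := stub_heavyQuarkBlockRemainder Nf hNf reg hreg
  choose Cf hCf using hclus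
  have hℓ₁ : 0 < Cℓ / Λs := div_pos hCℓ hΛs
  obtain ⟨M₅, hM₅⟩ := hquark (Cℓ / Λs) κ c (εs / 2) hℓ₁ hκ hc (half_pos hεs)
  obtain ⟨M₆, hM₆⟩ := stub_fineFromBlockCS Nf hNf reg hreg (Cℓ / Λs) c mr hℓ₁ hc hmr
  refine ⟨max M₅ M₆, fun m hm => ⟨mr / (4 * (Cℓ / Λs)), by positivity, ?_⟩⟩
  have hm5 : ∀ f, M₅ < m f := fun f => lt_of_le_of_lt (le_max_left _ _) (hm f)
  have hm6 : ∀ f, M₆ < m f := fun f => lt_of_le_of_lt (le_max_right _ _) (hm f)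
  obtain ⟨β', Λ', hΛ', haf, hq⟩ := hM₅ m hm5
  have hΛ'pos : 0 < Λ' := lt_of_lt_of_le hΛs hΛ'
  have hℓ₁' : Cℓ / Λ' ≤ Cℓ / Λs := div_le_div_of_nonneg_left hCℓ.le hΛs hΛ'
  have hym := hdata Λ' hΛ'pos (Cℓ / Λs) hℓ₁' reg.a reg.a_pos reg.tendsto_a β' haf
  refine hM₆ m hm6 β' ⟨Cf, ?_⟩
  filter_upwards [hym, hq] with k hk hk' S'' N _ h1 h2
  obtain ⟨βe, D, O, hβe, hDd, -, -, hOε, hOrc, hrep⟩ := hk S'' N h1 h2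
  obtain ⟨W', Z, hW'ε, hW'rc, hZ, hid⟩ := hk' S'' N h1 h2
  refine ⟨βe, D, O, W', Z, hZ, hrep, hid, fun A B n hn => ?_⟩
  have hβe' : |βe| ≤ εs := hβe.trans (by linarith)
  -- robustness = THIS triangle inequality for the KP norm (Dobrushin's condition is open):
  have hOW : (O + W').NormLE κ εs := (hOε.add hW'ε).mono (by linarith)
  have hrc := rangeControl_add2 O W' hOrc hW'rc
  have hassoc : D + O + W' = D + (O + W') :=
    QuasiLocalGaugePerturbation.ext (by funext X U; simp [add_assoc])
  rw [hassoc]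
  exact hCf A B βe hβe' S'' D (O + W') hDd hOW hrc n hn

/-- **Item `GradientFlowSpecies.MassiveLatticeGap` (8922) BY NAME from this line** (drop the species clause).
[folklore] -/
theorem massiveLatticeGap_of_stubs :
    Summit.QuantumFields.QCD.Theses.GradientFlowSpecies.MassiveLatticeGap := by
  intro Nf hNf reg hreg
  obtain ⟨M, hM⟩ := latticeGappedCS_of_stubs Nf hNf reg hreg
  exact ⟨M, fun m hm => by
    obtain ⟨Δ, hΔ, hL, -⟩ := hM m hm
    exact ⟨Δ, hΔ, hL⟩⟩

/-! ## §3 The head after the re-type: X₀ ⇒ the threshold-form conjunct (sorry-free outside the stubs), and the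
chiral completion (stub 7) ⇒ the crux BY NAME -/

/-- **The heavy-quark handover, honestly typed after the re-type**: `ContinuumQCDExists → QCDOfAboveThreshold N_f`
for `N_f = 2, 3`, over X₀'s OWN regularisation (no `m_crit` shift): X₀ gives `reg` with `HasMassScaling` and the
honest body; §2 gives the threshold `M` and, for `m > max M 0`, ONE `Δ > 0` with the lattice gap of
`reg.scheme m 0 0` — the same clause for `reg.scheme m z shift`, which has the same `β, mq, L, a` (`Iff.rfl`) — and the
species clustering of `reg.scheme m z shift`, which the LANDED Literature transfer
`IsQCDAlong.hasMassGap_of_hasSpeciesCSClustering` turns into `T.HasMassGap Δ` for X₀'s own witness `T`.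
[folklore] -/
theorem aboveThreshold_of_stubs (hX : ContinuumQCDExists) :
    ∀ Nf : ℕ, Nf = 2 ∨ Nf = 3 → QCDOfAboveThreshold Nf := by
  intro Nf hNf
  obtain ⟨reg, hms, hb⟩ := hX Nf hNf
  obtain ⟨M, hM⟩ := latticeGappedCS_of_stubs Nf hNf reg ⟨hms, hb⟩
  refine ⟨max M 0, le_max_right _ _, reg, hms, fun m hm => ?_⟩
  have hm0 : ∀ f, 0 < m f := fun f => lt_of_le_of_lt (le_max_right M 0) (hm f)
  have hmM : ∀ f, M < m f := fun f => lt_of_le_of_lt (le_max_left M 0) (hm f)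
  obtain ⟨z, shift, T, hA, hN, hG, hP⟩ := hb m hm0
  obtain ⟨Δ, hΔ, hLat, hCS⟩ := hM m hmM
  have hLat' : (reg.scheme m z shift).HasLatticeMassGap Δ := hLat
  exact ⟨z, shift, T, hA, hN, hG, hP, Δ, hΔ, hA.hasMassGap_of_hasSpeciesCSClustering (hCS z shift), hLat'⟩

/-- **RobustYangMillsHandover_of — the line closes the crux modulo exactly the registered stubs**
(conclusion = the route decl BY NAME, against the RE-TYPED `QCD`: stubs 2, 5, 6 (+ the landed 3a/3b/4′) pay the
heavy-quark handover `aboveThreshold_of_stubs`; stub 7 is the chiral completion the re-type added). -/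
theorem RobustYangMillsHandover_of :
    Summit.QuantumFields.QCD.Theses.HeatSlicedQuarks.RobustYangMillsHandover :=
  fun hX => stub_chiralCompletion (aboveThreshold_of_stubs hX)

/-! ## §4 Sanity links (sorry-free, not registered) -/

/-- The re-typed conjunct implies its threshold form (`M₀ = 0`); the converse is stub 7's business. [folklore] -/
theorem qcdOf_imp_aboveThreshold (Nf : ℕ) : QCDOf Nf → QCDOfAboveThreshold Nf := by
  rintro ⟨reg, hMS, -, h⟩
  exact ⟨0, le_rfl, reg, hMS, h⟩

/-- Sanity link: the crux IS the arrow §3 concludes, with the re-typed consequent. [folklore] -/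
theorem robustYangMillsHandover_iff :
    Summit.QuantumFields.QCD.Theses.HeatSlicedQuarks.RobustYangMillsHandover ↔
      (ContinuumQCDExists → QCDOf 2 ∧ QCDOf 3) :=
  Iff.rfl

end Summit.QuantumFields.QCD.Cruxes.RobustYangMillsHandover.TwoScaleLsiHandover

end
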